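/-
Copyright: the b2b-balaban T⁴-continuum CRUX team, row NE7b leaf lineage `t4-ne7b-formalise-leaf-03` (gen 148). Project licence.
-/
import Summits.QuantumFields.BalabanUV.T4Continuum.Spine.NE7b.HardStepChartRadius
import Summits.QuantumFields.BalabanUV.T4Continuum.Spine.NE7b.HardStepBranchDeriv
import Summits.QuantumFields.BalabanUV.T4Continuum.Spine.NE7b.AugmentedLagrangianEquivalence
import Summits.QuantumFields.BalabanUV.T4Continuum.Spine.NE7b.KKTChartDerivative

/-!
# THE NONLINEAR-CONSTRAINT HARD STEP ASSEMBLED: THE KKT BRANCH `w ↦ (δ(w), λ(w))` — EXISTENCE ON AN EXPLICIT BALL, LIPSCHITZ AND `C¹`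
# WITH EXPLICIT CONSTANTS — FROM KERNEL COERCIVITY OF THE LAGRANGIAN FORM, A RIGHT INVERSE, AND SECOND-DERIVATIVE MODULI ONLY
# (row NE7b, node U5c; the junction of leaf-04's `…HardStepChartRadius` (HSCR) ∕ `…HardStepBranchDeriv` (HSBD) with this lineage's
# `…AugmentedLagrangianEquivalence` (ALE) ∕ `…KKTChartDerivative` (KCD), every parent BY NAME; idea-1 T-85 (L2) ∕ T-93 (b); [B11] CMP 102
# (59)–(62), (70)–(71); [folklore])

Cell `pub-balaban`, sub-cell `t4`, spine estimate NE7b (`T4WeightBudget.RelWeightBound`; the cell's OWN estimate — NOT PRINTED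
in [Bałaban 1983–89], NOT PROVED).  Crux-route work under `Spine/NE7b/` by leaf-03 (CRUX team (2), FREEZE (0) crux-prover clause).
NOTHING of Bałaban's is named, asserted, valued or discharged; no `T4Continuum/Support` leaf typed; no `def`; zero `sorry`; no new
analysis — two junction theorems over four tree files BY NAME.

WHY.  For the hard step with a nonlinear constraint `G δ = w` the critical points are the KKT pairs; the four parents give:
ALE — the KKT operator `K` at `(δ₀, λ₀)` is an equivalence with `‖K⁻¹ y‖ ≤ N′‖y‖` from kernel coercivity `m` of the Lagrangian form
`P₀ − λ₀ ∘ C₀` on `ker T` and a right inverse `N` of `T`; KCD — the primal–dual map `Φ(δ, λ) = (G δ, L δ − λ ∘ G′ δ)` is differentiable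
with `‖DΦ − K‖ ≤ 2a + b + Λe + ρ‖C₀‖` from the moduli; HSCR — a chart of radius `r` with `c < N′⁻¹` has a slice branch on the ball of
radius `(N′⁻¹ − c) r`, `(N′⁻¹ − c)⁻¹`-Lipschitz; HSBD — the branch is differentiable with derivative `A_w⁻¹ ∘ inl`, `A_w = DΦ(σ w)`.
This file states the composite once, so that a consumer cites ONE theorem with ALL letters displayed and NONE abstract.

WHAT IS PROVED ([folklore]).  Letters: `E` complete real inner-product space, nontrivial; `F` real normed; `G, G′, G″, L, L′` with
`HasFDerivAt` letters on the primal–dual ball `closedBall x₀ r` (first coordinate); `T : E →L F` with right inverse `N`; `P₀, C₀, λ₀`;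
kernel coercivity `∀ κ, T κ = 0 → m‖κ‖² ≤ (P₀ − postcomp λ₀ ∘ C₀) κ κ` (`0 < m`); `N′ : ℝ≥0` dominating ALE's constant; moduli ∕ sizes
`a, b, e, Λ, ρ` on the ball with `2a + b + Λe + ρ‖C₀‖ ≤ c`, `c < N′⁻¹`.
* **`exists_kktBranch`** — `∃ σ : F → E × (F →L ℝ)` with `σ (Φ x₀).1 = x₀`; on `closedBall (Φ x₀).1 ((N′⁻¹ − c) r)`: `σ w ∈ closedBall x₀ r`,
  `(Φ (σ w)).1 = w` (the constraint `G (σ w).1 = w`), `(Φ (σ w)).2 = (Φ x₀).2` (the KKT residual is that of the base point — `0` when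
  `x₀` is a KKT pair); `σ` is `(N′⁻¹ − c)⁻¹`-Lipschitz there; uniqueness on the slice inside `closedBall x₀ r`.
* **`exists_kktBranch_hasFDerivAt`** — the same `σ`, and for every `w` in the OPEN ball: an equivalence `A` with
  `(A : _ →L _) = fderiv ℝ Φ (σ w)`, `‖A⁻¹ z‖ ≤ (N′⁻¹ − c)⁻¹‖z‖`, `HasFDerivAt σ (A⁻¹ ∘ inl) w`, `‖A⁻¹ ∘ inl‖ ≤ (N′⁻¹ − c)⁻¹`.

NOT HERE (honest): which `V, G, δ₀, λ₀` and sizes are Bałaban's ((A3) ∕ (A1c), NC-NE7b-α UNRULED); the value side (`V ∘ σ`'s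
derivatives: HSAH ∕ HSTH ∕ HSTL are the linear-constraint files; their KKT twins are not typed); the modulus of `σ′` (HSBDM's twin).
BY-NAME EFFECT ON THE WALL: NONE.  NE7b NOT PRINTED ∕ NOT PROVED; spine PROVED 0∕9; rung (B)+1 on a FINITE torus — NOT infinite volume,
NOT the mass gap, NOT Clay.  HONEST DEPENDENCY: continuum YM on T⁴ ⇐ BetaPertH ∧ nine spine estimates (0/9 proved); BetaPertH ⇐ (D1) ∧
(D4) ∧ CAP+tail; G-an2-4 gates asym, D1 and NE2∕3∕4.
-/

set_option autoImplicit false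

noncomputable section

namespace Summit.QuantumFields.BalabanUV.T4Continuum.NE7b.HardStepKKTBranch

open Metric
open scoped NNReal
open Summit.QuantumFields.BalabanUV.T4Continuum.NE7b.HardStepChartRadius
  (exists_sliceBranch approximatesLinearOn_of_norm_fderiv_sub_le)
open Summit.QuantumFields.BalabanUV.T4Continuum.NE7b.HardStepBranchDeriv (hasFDerivAt_sliceBranch_of_chart)
open Summit.QuantumFields.BalabanUV.T4Continuum.NE7b.AugmentedLagrangianEquivalence (exists_kkt_equiv_nnreal)
open Summit.QuantumFields.BalabanUV.T4Continuum.NE7b.KKTChartDerivative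
  (norm_fderiv_kktMap_sub_le differentiableAt_kktMap)

variable {E F : Type*} [NormedAddCommGroup E] [InnerProductSpace ℝ E] [CompleteSpace E] [Nontrivial E]
  [NormedAddCommGroup F] [NormedSpace ℝ F]

/-- **THE KKT BRANCH OF THE NONLINEAR-CONSTRAINT HARD STEP** — existence on the ball of radius `(N′⁻¹ − c) r`, `(N′⁻¹ − c)⁻¹`-Lipschitz,
uniqueness on the slice — from kernel coercivity of the Lagrangian form on `ker T`, a right inverse `N` of `T`, the three derivative
letters and five moduli on `closedBall x₀ r`, and `2a + b + Λe + ρ‖C₀‖ ≤ c < N′⁻¹` (ALE ∘ KCD ∘ HSCR, by name). [folklore] -/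
theorem exists_kktBranch
    {G : E → F} {G' : E → E →L[ℝ] F} {G'' : E → E →L[ℝ] E →L[ℝ] F} {L : E → E →L[ℝ] ℝ} {L' : E → E →L[ℝ] E →L[ℝ] ℝ}
    {T : E →L[ℝ] F} {N : F →L[ℝ] E} (hN : ∀ w, T (N w) = w) {P₀ : E →L[ℝ] E →L[ℝ] ℝ} {C₀ : E →L[ℝ] E →L[ℝ] F}
    {lam₀ : F →L[ℝ] ℝ} {m : ℝ} (hm : 0 < m)
    (hco : ∀ κ, T κ = 0 → m * ‖κ‖ ^ 2 ≤ (P₀ - ((ContinuousLinearMap.compL ℝ E F ℝ) lam₀).comp C₀) κ κ)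
    {N' c : ℝ≥0}
    (hN' : ((1 + ‖P₀ - ((ContinuousLinearMap.compL ℝ E F ℝ) lam₀).comp C₀‖ / m) * ‖N‖ + m⁻¹) +
      ‖N‖ * (‖P₀ - ((ContinuousLinearMap.compL ℝ E F ℝ) lam₀).comp C₀‖ *
        ((1 + ‖P₀ - ((ContinuousLinearMap.compL ℝ E F ℝ) lam₀).comp C₀‖ / m) * ‖N‖ + m⁻¹) + 1) ≤ (N' : ℝ))
    (hc : c < N'⁻¹) {x₀ : E × (F →L[ℝ] ℝ)} {r : ℝ} (hr : 0 ≤ r) {a b e Λ ρ : ℝ}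
    (hG : ∀ x ∈ closedBall x₀ r, HasFDerivAt G (G' x.1) x.1) (hG' : ∀ x ∈ closedBall x₀ r, HasFDerivAt G' (G'' x.1) x.1)
    (hL : ∀ x ∈ closedBall x₀ r, HasFDerivAt L (L' x.1) x.1)
    (ha : ∀ x ∈ closedBall x₀ r, ‖G' x.1 - T‖ ≤ a) (hb : ∀ x ∈ closedBall x₀ r, ‖L' x.1 - P₀‖ ≤ b)
    (he : ∀ x ∈ closedBall x₀ r, ‖G'' x.1 - C₀‖ ≤ e) (hΛ : ∀ x ∈ closedBall x₀ r, ‖x.2‖ ≤ Λ)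
    (hρ : ∀ x ∈ closedBall x₀ r, ‖x.2 - lam₀‖ ≤ ρ) (hcdef : 2 * a + b + Λ * e + ρ * ‖C₀‖ ≤ (c : ℝ)) :
    ∃ σ : F → E × (F →L[ℝ] ℝ),
      σ (G x₀.1, L x₀.1 - x₀.2.comp (G' x₀.1)).1 = x₀ ∧
      (∀ w ∈ closedBall (G x₀.1, L x₀.1 - x₀.2.comp (G' x₀.1)).1 (((N' : ℝ)⁻¹ - c) * r),
        σ w ∈ closedBall x₀ r ∧
          (G (σ w).1, L (σ w).1 - (σ w).2.comp (G' (σ w).1)).1 = w ∧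
          (G (σ w).1, L (σ w).1 - (σ w).2.comp (G' (σ w).1)).2 = (G x₀.1, L x₀.1 - x₀.2.comp (G' x₀.1)).2) ∧
      LipschitzOnWith (N'⁻¹ - c)⁻¹ σ (closedBall (G x₀.1, L x₀.1 - x₀.2.comp (G' x₀.1)).1 (((N' : ℝ)⁻¹ - c) * r)) ∧
      (∀ δ ∈ closedBall x₀ r,
        (G δ.1, L δ.1 - δ.2.comp (G' δ.1)).2 = (G x₀.1, L x₀.1 - x₀.2.comp (G' x₀.1)).2 →
          σ (G δ.1, L δ.1 - δ.2.comp (G' δ.1)).1 = δ) := by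
  obtain ⟨K, hK, hKN⟩ :=
    exists_kkt_equiv_nnreal (Q := P₀ - ((ContinuousLinearMap.compL ℝ E F ℝ) lam₀).comp C₀) hN hm hco hN'
  have hK' : ∀ (h : E) (μ : F →L[ℝ] ℝ),
      (K : (E × (F →L[ℝ] ℝ)) →L[ℝ] (F × (E →L[ℝ] ℝ))) (h, μ) = (T h, P₀ h - lam₀.comp (C₀ h) - μ.comp T) := fun h μ => by
    rw [ContinuousLinearEquiv.coe_coe, hK]
    rfl
  have hcK := norm_fderiv_kktMap_sub_le (K : (E × (F →L[ℝ] ℝ)) →L[ℝ] (F × (E →L[ℝ] ℝ))) hK' hG hG' hL ha hb he hΛ hρ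
  have hΦ := approximatesLinearOn_of_norm_fderiv_sub_le (K : (E × (F →L[ℝ] ℝ)) →L[ℝ] (F × (E →L[ℝ] ℝ)))
    (convex_closedBall x₀ r) (differentiableAt_kktMap hG hG' hL) (c := c) (fun x hx => (hcK x hx).trans hcdef)
  exact exists_sliceBranch (Φ := fun y : E × (F →L[ℝ] ℝ) => (G y.1, L y.1 - y.2.comp (G' y.1))) K hr hKN hc hΦ

/-- **THE KKT BRANCH IS `C¹` WITH CONSTANTS**: the branch of `exists_kktBranch`, and for EVERY `w` in the OPEN ball
`ball (Φ x₀).1 ((N′⁻¹ − c) r)` an equivalence `A` with `(A : _ →L _) = fderiv ℝ Φ (σ w)`, `‖A⁻¹ z‖ ≤ (N′⁻¹ − c)⁻¹‖z‖`,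
`HasFDerivAt σ (A⁻¹ ∘ inl) w` and `‖A⁻¹ ∘ inl‖ ≤ (N′⁻¹ − c)⁻¹` (HSBD `hasFDerivAt_sliceBranch_of_chart`, by name). [folklore] -/
theorem exists_kktBranch_hasFDerivAt
    {G : E → F} {G' : E → E →L[ℝ] F} {G'' : E → E →L[ℝ] E →L[ℝ] F} {L : E → E →L[ℝ] ℝ} {L' : E → E →L[ℝ] E →L[ℝ] ℝ}
    {T : E →L[ℝ] F} {N : F →L[ℝ] E} (hN : ∀ w, T (N w) = w) {P₀ : E →L[ℝ] E →L[ℝ] ℝ} {C₀ : E →L[ℝ] E →L[ℝ] F}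
    {lam₀ : F →L[ℝ] ℝ} {m : ℝ} (hm : 0 < m)
    (hco : ∀ κ, T κ = 0 → m * ‖κ‖ ^ 2 ≤ (P₀ - ((ContinuousLinearMap.compL ℝ E F ℝ) lam₀).comp C₀) κ κ)
    {N' c : ℝ≥0}
    (hN' : ((1 + ‖P₀ - ((ContinuousLinearMap.compL ℝ E F ℝ) lam₀).comp C₀‖ / m) * ‖N‖ + m⁻¹) +
      ‖N‖ * (‖P₀ - ((ContinuousLinearMap.compL ℝ E F ℝ) lam₀).comp C₀‖ *
        ((1 + ‖P₀ - ((ContinuousLinearMap.compL ℝ E F ℝ) lam₀).comp C₀‖ / m) * ‖N‖ + m⁻¹) + 1) ≤ (N' : ℝ))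
    (hc : c < N'⁻¹) {x₀ : E × (F →L[ℝ] ℝ)} {r : ℝ} (hr : 0 ≤ r) {a b e Λ ρ : ℝ}
    (hG : ∀ x ∈ closedBall x₀ r, HasFDerivAt G (G' x.1) x.1) (hG' : ∀ x ∈ closedBall x₀ r, HasFDerivAt G' (G'' x.1) x.1)
    (hL : ∀ x ∈ closedBall x₀ r, HasFDerivAt L (L' x.1) x.1)
    (ha : ∀ x ∈ closedBall x₀ r, ‖G' x.1 - T‖ ≤ a) (hb : ∀ x ∈ closedBall x₀ r, ‖L' x.1 - P₀‖ ≤ b)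
    (he : ∀ x ∈ closedBall x₀ r, ‖G'' x.1 - C₀‖ ≤ e) (hΛ : ∀ x ∈ closedBall x₀ r, ‖x.2‖ ≤ Λ)
    (hρ : ∀ x ∈ closedBall x₀ r, ‖x.2 - lam₀‖ ≤ ρ) (hcdef : 2 * a + b + Λ * e + ρ * ‖C₀‖ ≤ (c : ℝ)) :
    ∃ σ : F → E × (F →L[ℝ] ℝ),
      σ (G x₀.1, L x₀.1 - x₀.2.comp (G' x₀.1)).1 = x₀ ∧
      (∀ w ∈ closedBall (G x₀.1, L x₀.1 - x₀.2.comp (G' x₀.1)).1 (((N' : ℝ)⁻¹ - c) * r),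
        σ w ∈ closedBall x₀ r ∧
          (G (σ w).1, L (σ w).1 - (σ w).2.comp (G' (σ w).1)).1 = w ∧
          (G (σ w).1, L (σ w).1 - (σ w).2.comp (G' (σ w).1)).2 = (G x₀.1, L x₀.1 - x₀.2.comp (G' x₀.1)).2) ∧
      LipschitzOnWith (N'⁻¹ - c)⁻¹ σ (closedBall (G x₀.1, L x₀.1 - x₀.2.comp (G' x₀.1)).1 (((N' : ℝ)⁻¹ - c) * r)) ∧
      ∀ w ∈ ball (G x₀.1, L x₀.1 - x₀.2.comp (G' x₀.1)).1 (((N' : ℝ)⁻¹ - c) * r),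
        ∃ A : (E × (F →L[ℝ] ℝ)) ≃L[ℝ] (F × (E →L[ℝ] ℝ)),
          (A : (E × (F →L[ℝ] ℝ)) →L[ℝ] (F × (E →L[ℝ] ℝ))) =
              fderiv ℝ (fun y : E × (F →L[ℝ] ℝ) => (G y.1, L y.1 - y.2.comp (G' y.1))) (σ w) ∧
          (∀ z : F × (E →L[ℝ] ℝ), ‖A.symm z‖ ≤ ((N' : ℝ)⁻¹ - c)⁻¹ * ‖z‖) ∧
          HasFDerivAt σ ((A.symm : (F × (E →L[ℝ] ℝ)) →L[ℝ] (E × (F →L[ℝ] ℝ))).comp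
            (ContinuousLinearMap.inl ℝ F (E →L[ℝ] ℝ))) w ∧
          ‖(A.symm : (F × (E →L[ℝ] ℝ)) →L[ℝ] (E × (F →L[ℝ] ℝ))).comp (ContinuousLinearMap.inl ℝ F (E →L[ℝ] ℝ))‖ ≤
            ((N' : ℝ)⁻¹ - c)⁻¹ := by
  obtain ⟨K, hK, hKN⟩ :=
    exists_kkt_equiv_nnreal (Q := P₀ - ((ContinuousLinearMap.compL ℝ E F ℝ) lam₀).comp C₀) hN hm hco hN'
  have hK' : ∀ (h : E) (μ : F →L[ℝ] ℝ),
      (K : (E × (F →L[ℝ] ℝ)) →L[ℝ] (F × (E →L[ℝ] ℝ))) (h, μ) = (T h, P₀ h - lam₀.comp (C₀ h) - μ.comp T) := fun h μ => by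
    rw [ContinuousLinearEquiv.coe_coe, hK]
    rfl
  have hcK := norm_fderiv_kktMap_sub_le (K : (E × (F →L[ℝ] ℝ)) →L[ℝ] (F × (E →L[ℝ] ℝ))) hK' hG hG' hL ha hb he hΛ hρ
  have hd := differentiableAt_kktMap hG hG' hL
  have hcK' : ∀ x ∈ closedBall x₀ r,
      ‖fderiv ℝ (fun y : E × (F →L[ℝ] ℝ) => (G y.1, L y.1 - y.2.comp (G' y.1))) x -
        (K : (E × (F →L[ℝ] ℝ)) →L[ℝ] (F × (E →L[ℝ] ℝ)))‖ ≤ c := fun x hx => (hcK x hx).trans hcdef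
  have hΦ := approximatesLinearOn_of_norm_fderiv_sub_le (K : (E × (F →L[ℝ] ℝ)) →L[ℝ] (F × (E →L[ℝ] ℝ)))
    (convex_closedBall x₀ r) hd (c := c) hcK'
  obtain ⟨σ, hσ0, hσ, hlip, huniq⟩ :=
    exists_sliceBranch (Φ := fun y : E × (F →L[ℝ] ℝ) => (G y.1, L y.1 - y.2.comp (G' y.1))) K hr hKN hc hΦ
  refine ⟨σ, hσ0, hσ, hlip, fun w hw => ?_⟩
  exact hasFDerivAt_sliceBranch_of_chart (Φ := fun y : E × (F →L[ℝ] ℝ) => (G y.1, L y.1 - y.2.comp (G' y.1)))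
    (Φ' := fun x => fderiv ℝ (fun y : E × (F →L[ℝ] ℝ) => (G y.1, L y.1 - y.2.comp (G' y.1))) x) K hKN hc
    (fun x hx => (hd x hx).hasFDerivAt) hcK' hσ hlip.continuousOn hw

end Summit.QuantumFields.BalabanUV.T4Continuum.NE7b.HardStepKKTBranch
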